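import Summits.AtomisticToContinuum.Crystallization.Theorems.FrustratedLawDichotomyTextureFlipGood
import Summits.AtomisticToContinuum.Crystallization.Theorems.FrustratedLawDichotomyTextureFlipBad
import Summits.AtomisticToContinuum.Crystallization.Theorems.FrustratedLawDichotomyTexturePropagation
import Summits.AtomisticToContinuum.Crystallization.Theorems.FrustratedLawDichotomyCoherentSets
import Summits.AtomisticToContinuum.Crystallization.Theorems.FrustratedLawDichotomyTextureIncoherence

/-!
# The LIFT `htex_of_coherentNet`: from a coherent host net to the texture input of the door #56

Route `FrustratedLawDichotomy`, residual crux `AperiodicFrustratedLawGap` (E′), texture side.  This file assembles the tree pieces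
(194) `…TextureFlipGood`, (195) `…TextureFlipBad` (one-window (FLIP) engines), (197) `…TexturePropagation` (chain-coherence propagation),
(189) `…CoherentSets` (`coherentAt`, its counting-measure reading) and #58 `…TextureIncoherence` (`ae_exists_incoherent_reroot`) into

* `ae_exists_incoherent_reroot_of_net` ★★ — under the crux hypotheses `hcore : ∀ᵐ μ ∂P, IsRootedHardCore δ μ`,
  `happr : ∀ᵐ μ ∂P, ApprM μ R₇ R₈ R₉` (the crux's OWN `R₇ R₈ R₉`, bound inside its hypothesis) and HOST-NET DATA at constants
  `τ, Rc, h, c, D, σ, ε` (below), almost surely some atom's re-rooting `Measure.map (· - p) μ` lies OUTSIDE `⋃ k, coherentAt (net k) τ Rc`.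
  This is the hypothesis `htex` of the door `…SignedLedgerTextureDoor.aperiodicFrustratedLawGap_of_texture_and_defectDensity` for the coherent
  class `C δ := ⋃ k, coherentAt (net k) τ Rc` (measurable by (189) `measurableSet_iUnion_coherentAt`); `Rc` is a CONSTANT of the net, the radii
  `ρ := max (max R₈ R₉) 0`, `R' := ρ + ε`, `R := D + (R' + (h + 2c) + ε) + ε` are chosen here AFTER `R₈, R₉` (FINDING r1714).

NET DATA (format of record r1714 (C) / r1715 (A)), `net : ι → Finset E3`, `good : ι → Prop`:
* `hG` — every GOOD template carries, at each site `x` with `‖x‖ ≤ h + 2c + τ`, the good-with-margin package of (194) §2 (frame `A`, scale `d₀`,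
  distortion `η₀`, clean gap `γ₀`, an fcc- or hcp-labelling `t₀` by template points, `η₀d₀ + 4τ < (d₀ − 2τ)/8`, `46/10·τ < γ₀`, window
  `‖x‖ + 13/10·d₀ + γ₀ + 4τ ≤ Rc`, engine numerics `80ε ≤ d₀ − 34τ − 8η₀d₀`, `10ε ≤ γ₀ − 46/10·τ`, and `2d₀ + γ₀ + 2 ≤ D`);
* `hB` — every BAD template is `2τ`-separated and carries, at each such site, a neighbour `z₁` at distance `≤ d₁` (`23/10·(d₁ + 2τ + 2ε) + 1 ≤ D`,
  `‖x‖ + τ + 9/8·(d₁ + 2τ + 2ε) + σ ≤ Rc`) and the fcc/hcp SOFT NO-MATCH CERTIFICATES of (195) with slack `σ` (to be discharged per finite row by the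
  owed `badCertificate_of_row`);
* `hcv` — every template is `(c − τ)`-covering on `closedBall 0 (h + c)`;
* numerics `0 ≤ τ`, `2τ < δ`, `0 < h`, `0 ≤ c`, `h + 2c ≤ Rc`, `0 ≤ D`, `0 < ε`, `8ε < δ`, `8ε < 7/10`, `0 < σ`, `4ε ≤ σ`.

Chain of proof.  `sep_image_sub`, `matching_fwd/bwd_image_sub`, `window_clauses`: re-rooting `S ↦ S − p` preserves separation, re-centres the
root matching at `−p`, and turns coherence of `S − p` into the three set clauses of the engines.  `gy_of_goodWindow` / `not_gy_of_badWindow`: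
an atom `q` with `dist p q ≤ h + 2c`, matched to the site `j`, gets the verdict of `p`'s host ((194) §2 / (195) on `S − p` at the template site
owning `q − p`).  `uniformVerdict_of_coherentAtoms`: with the host verdict `V p := ∃ k, (S − p coherent with net k) ∧ good k` these are the
window verdicts `hwin` of (197), the covering `hcov` comes from `hcv` + the nonempty template balls, and (197)
`uniformVerdict_of_windowVerdict_of_cover` gives the uniform `1/8`-verdict on the `ρ`-ball.  `hflip_of_net`: the counting-measure reading
((189) `count_restrict_mem_coherentAt_iff'`, `Literature…map_sub_count_restrict`, `count_restrict_singleton_ne_zero_iff`).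
`ae_exists_incoherent_reroot_of_net`: #58 `ae_exists_incoherent_reroot` (statement quoted in the docstring) with `hflip` a.s. from `hflip_of_net`.

Design: DEF-FREE; every hypothesis explicit; no radius of the crux is constrained (only `R₈, R₉ ≤ ρ`, chosen here).  What remains OWED to make
`htex` unconditional: the finite net itself with its GOOD packages / BAD rows (hand-1 desk at `τ := 1/128`, `Rc := 13`) and `badCertificate_of_row`.
-/

noncomputable section

namespace Summit.AtomisticToContinuum.Crystallization.Theorems.FrustratedLawDichotomyTextureLift

open MeasureTheory Metric Set Filter
open Literature.Geometry.DiscreteGeometry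
open Literature.Probability.Process
open Summit.AtomisticToContinuum.Crystallization.Theorems.RepetitiveNetworkReductionRecurrentMember (Gy TexBall ApprM)

/-- Separation is preserved by re-rooting. [folklore] -/
theorem sep_image_sub {S : Set (EuclideanSpace ℝ (Fin 3))} {δ : ℝ} (hS : ∀ x ∈ S, ∀ x' ∈ S, x ≠ x' → δ ≤ dist x x')
    (p : EuclideanSpace ℝ (Fin 3)) :
    ∀ x ∈ (fun s => s - p) '' S, ∀ x' ∈ (fun s => s - p) '' S, x ≠ x' → δ ≤ dist x x' := by
  rintro _ ⟨s, hs, rfl⟩ _ ⟨s', hs', rfl⟩ hne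
  rw [dist_sub_right]
  exact hS s hs s' hs' fun h => hne (by rw [h])

/-- The root matching, re-rooted at the atom `p`: forward direction. [folklore] -/
theorem matching_fwd_image_sub {S : Set (EuclideanSpace ℝ (Fin 3))} {N : ℕ} {y : Fin N → EuclideanSpace ℝ (Fin 3)} {i : Fin N} {R ε : ℝ}
    (hm1 : ∀ s ∈ S, dist s (0 : EuclideanSpace ℝ (Fin 3)) ≤ R → ∃ b : Fin N, dist (y b - y i) (s - 0) ≤ ε) (p : EuclideanSpace ℝ (Fin 3)) :
    ∀ s ∈ (fun s => s - p) '' S, dist s (-p) ≤ R → ∃ b : Fin N, dist (y b - y i) (s - (-p)) ≤ ε := by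
  rintro _ ⟨s, hs, rfl⟩ hsR
  have h1 : s - p - (-p) = s - 0 := by rw [sub_neg_eq_add, sub_add_cancel, sub_zero]
  rw [dist_eq_norm, h1, sub_zero, ← dist_zero_right] at hsR
  obtain ⟨b, hb⟩ := hm1 s hs hsR
  exact ⟨b, by rwa [h1]⟩

/-- The root matching, re-rooted at the atom `p`: backward direction. [folklore] -/
theorem matching_bwd_image_sub {S : Set (EuclideanSpace ℝ (Fin 3))} {N : ℕ} {y : Fin N → EuclideanSpace ℝ (Fin 3)} {i : Fin N} {R ε : ℝ}
    (hm2 : ∀ b : Fin N, dist (y b) (y i) ≤ R → ∃ s ∈ S, dist (y b - y i) (s - 0) ≤ ε) (p : EuclideanSpace ℝ (Fin 3)) :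
    ∀ b : Fin N, dist (y b) (y i) ≤ R → ∃ s ∈ (fun s => s - p) '' S, dist (y b - y i) (s - (-p)) ≤ ε := by
  intro b hb
  obtain ⟨s, hs, h⟩ := hm2 b hb
  refine ⟨s - p, ⟨s, hs, rfl⟩, ?_⟩
  have h1 : s - p - (-p) = s - 0 := by rw [sub_neg_eq_add, sub_add_cancel, sub_zero]
  rwa [h1]

/-- The coherent window of the re-rooted configuration, read as the three set-level clauses the (FLIP) engines consume. [folklore] -/
theorem window_clauses {S : Set (EuclideanSpace ℝ (Fin 3))} {δ τ Rc : ℝ} (hS : ∀ x ∈ S, ∀ x' ∈ S, x ≠ x' → δ ≤ dist x x') (h2τ : 2 * τ < δ)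
    (p : EuclideanSpace ℝ (Fin 3)) {a : Finset (EuclideanSpace ℝ (Fin 3))}
    (hne : ∀ x ∈ a, (closedBall x τ ∩ (fun s => s - p) '' S).Nonempty)
    (hsub : (fun s => s - p) '' S ∩ closedBall (0 : EuclideanSpace ℝ (Fin 3)) Rc ⊆ ⋃ x ∈ a, closedBall x τ) :
    (∀ x ∈ a, ∃ s, s ∈ closedBall x τ ∩ (fun s => s - p) '' S) ∧
      (∀ x ∈ a, (closedBall x τ ∩ (fun s => s - p) '' S).Subsingleton) ∧
      (∀ s ∈ (fun s => s - p) '' S, s ∈ closedBall (0 : EuclideanSpace ℝ (Fin 3)) Rc → ∃ x ∈ a, s ∈ closedBall x τ) := by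
  refine ⟨fun x hx => hne x hx, fun x _ => ?_, fun s hs hsR => ?_⟩
  · exact FrustratedLawDichotomyCoherentSets.subsingleton_closedBall_inter_of_separated (sep_image_sub hS p) h2τ x
  · have h1 := hsub ⟨hs, hsR⟩
    simp only [mem_iUnion, exists_prop] at h1
    exact h1

/-- ★ **Window verdict, GOOD host.**  `S` `δ`-separated (`2τ < δ`), the re-rooted configuration `S − p` coherent (`τ`, window `Rc`) with a template
`a` every site `x` of which with `‖x‖ ≤ L + τ` is GOOD WITH MARGIN (package + engine numerics at the matching tolerance `ε`, `2d₀ + γ₀ + 2 ≤ D`);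
the root matching of `S` with `y` (radius `R`, tolerance `ε`); an atom `q` with `dist p q ≤ L ≤ Rc` matched to the site `j` (`dist (y j) (y i) ≤ ρ`,
`D + ρ + ε ≤ R`).  Then `Gy (1/8) N y j` (`…TextureFlipGood.gy_eighth_of_template_matched` on `S − p`). [folklore] -/
theorem gy_of_goodWindow
    {S : Set (EuclideanSpace ℝ (Fin 3))} {δ τ Rc L D : ℝ} (hS : ∀ x ∈ S, ∀ x' ∈ S, x ≠ x' → δ ≤ dist x x') (hτ : 0 ≤ τ) (h2τ : 2 * τ < δ)
    (hLRc : L ≤ Rc) {p q : EuclideanSpace ℝ (Fin 3)} (hq : q ∈ S) (hpq : dist p q ≤ L)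
    {a : Finset (EuclideanSpace ℝ (Fin 3))}
    (hne : ∀ x ∈ a, (closedBall x τ ∩ (fun s => s - p) '' S).Nonempty)
    (hsub : (fun s => s - p) '' S ∩ closedBall (0 : EuclideanSpace ℝ (Fin 3)) Rc ⊆ ⋃ x ∈ a, closedBall x τ)
    {N : ℕ} {y : Fin N → EuclideanSpace ℝ (Fin 3)} {i j : Fin N} {R ρ ε : ℝ}
    (hsepY : ∀ a b : Fin N, a ≠ b → (7 : ℝ) / 10 ≤ dist (y a) (y b))
    (hm1 : ∀ s ∈ S, dist s (0 : EuclideanSpace ℝ (Fin 3)) ≤ R → ∃ b : Fin N, dist (y b - y i) (s - 0) ≤ ε)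
    (hm2 : ∀ b : Fin N, dist (y b) (y i) ≤ R → ∃ s ∈ S, dist (y b - y i) (s - 0) ≤ ε)
    (hj : dist (y j - y i) (q - 0) ≤ ε) (hjρ : dist (y j) (y i) ≤ ρ)
    (hε0 : 0 < ε) (hεδ : 8 * ε < δ) (hε7 : 8 * ε < 7 / 10) (hR : D + ρ + ε ≤ R)
    (hG : ∀ x ∈ a, ‖x‖ ≤ L + τ →
      ∃ (A : EuclideanSpace ℝ (Fin 3) →ₗᵢ[ℝ] EuclideanSpace ℝ (Fin 3)) (d₀ η₀ γ₀ : ℝ), 0 < d₀ ∧ 0 ≤ η₀ ∧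
        (∀ z ∈ a, z ≠ x → d₀ ≤ dist z x) ∧ (∃ z ∈ a, z ≠ x ∧ dist z x ≤ d₀) ∧
        η₀ * d₀ + 4 * τ < 1 / 8 * (d₀ - 2 * τ) ∧ 46 / 10 * τ < γ₀ ∧ ‖x‖ + 13 / 10 * d₀ + γ₀ + 4 * τ ≤ Rc ∧
        80 * ε ≤ d₀ - 34 * τ - 8 * (η₀ * d₀) ∧ 10 * ε ≤ γ₀ - 46 / 10 * τ ∧ 2 * d₀ + γ₀ + 2 ≤ D ∧
        ((∃ t₀ : ↥fccKissingPattern → EuclideanSpace ℝ (Fin 3),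
            (∀ u : ↥fccKissingPattern, t₀ u ∈ a ∧ ‖(t₀ u - x) - d₀ • A (u : EuclideanSpace ℝ (Fin 3))‖ ≤ η₀ * d₀) ∧
            (∀ z ∈ a, z ≠ x → dist z x < 13 / 10 * d₀ + γ₀ → dist z x ≤ 13 / 10 * d₀ - γ₀ ∧ z ∈ Set.range t₀)) ∨
         (∃ t₀ : ↥hcpKissingPattern → EuclideanSpace ℝ (Fin 3),
            (∀ u : ↥hcpKissingPattern, t₀ u ∈ a ∧ ‖(t₀ u - x) - d₀ • A (u : EuclideanSpace ℝ (Fin 3))‖ ≤ η₀ * d₀) ∧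
            (∀ z ∈ a, z ≠ x → dist z x < 13 / 10 * d₀ + γ₀ → dist z x ≤ 13 / 10 * d₀ - γ₀ ∧ z ∈ Set.range t₀)))) :
    Gy (1 / 8) N y j := by
  obtain ⟨hC1, hC1', hC2⟩ := window_clauses hS h2τ p hne hsub
  have hp₁ : q - p ∈ (fun s => s - p) '' S := ⟨q, hq, rfl⟩
  have hj' : dist (y j - y i) (q - p - (-p)) ≤ ε := by rwa [sub_neg_eq_add, sub_add_cancel, ← sub_zero q]
  have hp₁R : q - p ∈ closedBall (0 : EuclideanSpace ℝ (Fin 3)) Rc := by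
    rw [mem_closedBall, dist_zero_right, ← dist_eq_norm, dist_comm]; exact hpq.trans hLRc
  obtain ⟨x₁, hx₁, hp₁x⟩ := hC2 _ hp₁ hp₁R
  have hx₁n : ‖x₁‖ ≤ L + τ := by
    have h1 : ‖x₁‖ ≤ ‖q - p‖ + dist (q - p) x₁ := by
      have := norm_sub_le (q - p) ((q - p) - x₁); rwa [sub_sub_cancel, ← dist_eq_norm] at this
    have h2 : dist (q - p) x₁ ≤ τ := mem_closedBall.mp hp₁x
    rw [← dist_eq_norm, dist_comm] at h1
    linarith
  obtain ⟨A, d₀, η₀, γ₀, hd₀, hη₀, hnn₀, hnn₀', hmarg₁, hmarg₂, hRc, hεη, hεγ, hD, hpat⟩ := hG x₁ hx₁ hx₁n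
  have hR' : 2 * d₀ + γ₀ + 2 ≤ R - ρ - ε := by linarith
  rcases hpat with ⟨t₀, ht₀, hgap₀⟩ | ⟨t₀, ht₀, hgap₀⟩
  · exact FrustratedLawDichotomyTextureFlipGood.gy_eighth_of_template_matched (sep_image_sub hS p) hτ hC1 hC1' hC2 hsepY
      (matching_fwd_image_sub hm1 p) (matching_bwd_image_sub hm2 p) hp₁ hj' hjρ hx₁ hp₁x (Or.inl rfl) hd₀ hη₀ ht₀ hnn₀ hnn₀' hgap₀
      hmarg₁ hmarg₂ hRc hε0 hεη hεγ hεδ hε7 hR'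
  · exact FrustratedLawDichotomyTextureFlipGood.gy_eighth_of_template_matched (sep_image_sub hS p) hτ hC1 hC1' hC2 hsepY
      (matching_fwd_image_sub hm1 p) (matching_bwd_image_sub hm2 p) hp₁ hj' hjρ hx₁ hp₁x (Or.inr rfl) hd₀ hη₀ ht₀ hnn₀ hnn₀' hgap₀
      hmarg₁ hmarg₂ hRc hε0 hεη hεγ hεδ hε7 hR'

/-- ★ **Window verdict, BAD host.**  As `gy_of_goodWindow`, with the template `2τ`-separated and every site `x` with `‖x‖ ≤ L + τ` BAD WITH MARGIN:
a template neighbour `z₁` at distance `≤ d₁` (`23/10·(d₁ + 2τ + 2ε) + 1 ≤ D`, window `‖x‖ + τ + 9/8·(d₁ + 2τ + 2ε) + σ ≤ Rc`) and the fcc/hcp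
soft no-match certificates with slack `σ` (`0 < σ`, `4ε ≤ σ`, `2ε < δ`).  Then `¬ Gy (1/8) N y j` (`…TextureFlipBad.not_gy_eighth_of_badTemplate`
on `S − p`). [folklore] -/
theorem not_gy_of_badWindow
    {S : Set (EuclideanSpace ℝ (Fin 3))} {δ τ Rc L D σ : ℝ} (hS : ∀ x ∈ S, ∀ x' ∈ S, x ≠ x' → δ ≤ dist x x') (hτ : 0 ≤ τ) (h2τ : 2 * τ < δ)
    (hLRc : L ≤ Rc) {p q : EuclideanSpace ℝ (Fin 3)} (hq : q ∈ S) (hpq : dist p q ≤ L)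
    {a : Finset (EuclideanSpace ℝ (Fin 3))} (ha : ∀ z ∈ a, ∀ z' ∈ a, z ≠ z' → 2 * τ < dist z z')
    (hne : ∀ x ∈ a, (closedBall x τ ∩ (fun s => s - p) '' S).Nonempty)
    (hsub : (fun s => s - p) '' S ∩ closedBall (0 : EuclideanSpace ℝ (Fin 3)) Rc ⊆ ⋃ x ∈ a, closedBall x τ)
    {N : ℕ} {y : Fin N → EuclideanSpace ℝ (Fin 3)} {i j : Fin N} {R ρ ε : ℝ}
    (hsepY : ∀ a b : Fin N, a ≠ b → (7 : ℝ) / 10 ≤ dist (y a) (y b))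
    (hm1 : ∀ s ∈ S, dist s (0 : EuclideanSpace ℝ (Fin 3)) ≤ R → ∃ b : Fin N, dist (y b - y i) (s - 0) ≤ ε)
    (hm2 : ∀ b : Fin N, dist (y b) (y i) ≤ R → ∃ s ∈ S, dist (y b - y i) (s - 0) ≤ ε)
    (hj : dist (y j - y i) (q - 0) ≤ ε) (hjρ : dist (y j) (y i) ≤ ρ)
    (hε0 : 0 ≤ ε) (hσ : 0 < σ) (h2ε : 2 * ε < δ) (h4ε : 4 * ε ≤ σ) (hR : D + ρ + ε ≤ R)
    (hB : ∀ x ∈ a, ‖x‖ ≤ L + τ → ∃ (z₁ : EuclideanSpace ℝ (Fin 3)) (d₁ : ℝ), z₁ ∈ a ∧ z₁ ≠ x ∧ dist z₁ x ≤ d₁ ∧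
      23 / 10 * (d₁ + 2 * τ + 2 * ε) + 1 ≤ D ∧ ‖x‖ + τ + 9 / 8 * (d₁ + 2 * τ + 2 * ε) + σ ≤ Rc ∧
      (∀ dk : ℝ, (7 : ℝ) / 10 ≤ dk → ∀ A : EuclideanSpace ℝ (Fin 3) →ₗᵢ[ℝ] EuclideanSpace ℝ (Fin 3),
        ¬ ((∀ u ∈ fccKissingPattern, ∃ z ∈ a, dist (z - x) (dk • A u) ≤ dk / 8 + σ + 2 * τ) ∧
            (∀ z ∈ a, z ≠ x → dist z x + σ + 4 * τ ≤ 13 / 10 * dk →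
              ∃ u ∈ fccKissingPattern, dist (z - x) (dk • A u) ≤ dk / 8 + σ + 2 * τ))) ∧
      (∀ dk : ℝ, (7 : ℝ) / 10 ≤ dk → ∀ A : EuclideanSpace ℝ (Fin 3) →ₗᵢ[ℝ] EuclideanSpace ℝ (Fin 3),
        ¬ ((∀ u ∈ hcpKissingPattern, ∃ z ∈ a, dist (z - x) (dk • A u) ≤ dk / 8 + σ + 2 * τ) ∧
            (∀ z ∈ a, z ≠ x → dist z x + σ + 4 * τ ≤ 13 / 10 * dk →
              ∃ u ∈ hcpKissingPattern, dist (z - x) (dk • A u) ≤ dk / 8 + σ + 2 * τ)))) :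
    ¬ Gy (1 / 8) N y j := by
  obtain ⟨hC1, -, hC2⟩ := window_clauses hS h2τ p hne hsub
  have hp₁ : q - p ∈ (fun s => s - p) '' S := ⟨q, hq, rfl⟩
  have hj' : dist (y j - y i) (q - p - (-p)) ≤ ε := by rwa [sub_neg_eq_add, sub_add_cancel, ← sub_zero q]
  have hp₁R : q - p ∈ closedBall (0 : EuclideanSpace ℝ (Fin 3)) Rc := by
    rw [mem_closedBall, dist_zero_right, ← dist_eq_norm, dist_comm]; exact hpq.trans hLRc
  obtain ⟨x₁, hx₁, hp₁x⟩ := hC2 _ hp₁ hp₁R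
  have hx₁n : ‖x₁‖ ≤ L + τ := by
    have h1 : ‖x₁‖ ≤ ‖q - p‖ + dist (q - p) x₁ := by
      have := norm_sub_le (q - p) ((q - p) - x₁); rwa [sub_sub_cancel, ← dist_eq_norm] at this
    have h2 : dist (q - p) x₁ ≤ τ := mem_closedBall.mp hp₁x
    rw [← dist_eq_norm, dist_comm] at h1
    linarith
  obtain ⟨z₁, d₁, hz₁, hz₁ne, hz₁d, hD, hRc, hbf, hbh⟩ := hB x₁ hx₁ hx₁n
  have hd₁0 : 0 ≤ d₁ := le_trans dist_nonneg hz₁d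
  have hR₁ : 13 / 10 * (d₁ + 2 * τ + 2 * ε) + (d₁ + 2 * τ + 2 * ε) + ρ + 1 ≤ R := by linarith
  have hR₂ : d₁ + 2 * τ + ρ + ε ≤ R := by nlinarith
  exact FrustratedLawDichotomyTextureFlipBad.not_gy_eighth_of_badTemplate (sep_image_sub hS p) hτ ha hC1 hC2 hsepY
    (matching_fwd_image_sub hm1 p) (matching_bwd_image_sub hm2 p) hp₁ hj' hjρ hx₁ hp₁x hz₁ hz₁ne hz₁d hσ h2ε h4ε hR₁ hR₂ hRc hbf hbh

/-- ★ **Uniform verdict from coherent atoms (set level).**  `S ∋ 0` `δ`-separated; every atom `p` with `‖p‖ ≤ R'` has its re-rooted window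
coherent (`τ`, `Rc`) with SOME template of the net (`hcoh`, the set reading of `θ_p μ ∈ ⋃ k, coherentAt (net k) τ Rc`); net data: GOOD templates
carry the good-with-margin package at every site of norm `≤ h + 2c + τ` (`hG`), BAD templates are `2τ`-separated and carry the neighbour datum and
the soft no-match certificates there (`hB`), every template is `(c − τ)`-covering on `closedBall 0 (h + c)` (`hcv`); the root matching with `y`
(radius `R`, tolerance `ε`) and the radii bookkeeping.  Then the sites of `y` within `ρ` of `y i` have a UNIFORM `1/8`-verdict. [folklore] -/
theorem uniformVerdict_of_coherentAtoms
    {S : Set (EuclideanSpace ℝ (Fin 3))} {δ τ Rc D σ h c : ℝ} (hS : ∀ x ∈ S, ∀ x' ∈ S, x ≠ x' → δ ≤ dist x x')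
    (h0 : (0 : EuclideanSpace ℝ (Fin 3)) ∈ S) (hτ : 0 ≤ τ) (h2τ : 2 * τ < δ) (hh : 0 < h) (hc : 0 ≤ c) (hLRc : h + 2 * c ≤ Rc)
    {ι : Type*} (net : ι → Finset (EuclideanSpace ℝ (Fin 3))) (good : ι → Prop)
    {N : ℕ} {y : Fin N → EuclideanSpace ℝ (Fin 3)} {i : Fin N} {R ρ R' ε : ℝ}
    (hsepY : ∀ a b : Fin N, a ≠ b → (7 : ℝ) / 10 ≤ dist (y a) (y b))
    (hm1 : ∀ s ∈ S, dist s (0 : EuclideanSpace ℝ (Fin 3)) ≤ R → ∃ b : Fin N, dist (y b - y i) (s - 0) ≤ ε)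
    (hm2 : ∀ b : Fin N, dist (y b) (y i) ≤ R → ∃ s ∈ S, dist (y b - y i) (s - 0) ≤ ε)
    (hε0 : 0 < ε) (hεδ : 8 * ε < δ) (hε7 : 8 * ε < 7 / 10) (hσ : 0 < σ) (h4ε : 4 * ε ≤ σ)
    (hρ : 0 ≤ ρ) (hρR' : ρ + ε ≤ R') (hRbig : D + (R' + (h + 2 * c) + ε) + ε ≤ R) (hR'R : R' ≤ R)
    (hcoh : ∀ p ∈ S, ‖p‖ ≤ R' → ∃ k : ι, (∀ x ∈ net k, (closedBall x τ ∩ (fun s => s - p) '' S).Nonempty) ∧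
      (fun s => s - p) '' S ∩ closedBall (0 : EuclideanSpace ℝ (Fin 3)) Rc ⊆ ⋃ x ∈ net k, closedBall x τ)
    (hG : ∀ k : ι, good k → ∀ x ∈ net k, ‖x‖ ≤ h + 2 * c + τ →
      ∃ (A : EuclideanSpace ℝ (Fin 3) →ₗᵢ[ℝ] EuclideanSpace ℝ (Fin 3)) (d₀ η₀ γ₀ : ℝ), 0 < d₀ ∧ 0 ≤ η₀ ∧
        (∀ z ∈ net k, z ≠ x → d₀ ≤ dist z x) ∧ (∃ z ∈ net k, z ≠ x ∧ dist z x ≤ d₀) ∧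
        η₀ * d₀ + 4 * τ < 1 / 8 * (d₀ - 2 * τ) ∧ 46 / 10 * τ < γ₀ ∧ ‖x‖ + 13 / 10 * d₀ + γ₀ + 4 * τ ≤ Rc ∧
        80 * ε ≤ d₀ - 34 * τ - 8 * (η₀ * d₀) ∧ 10 * ε ≤ γ₀ - 46 / 10 * τ ∧ 2 * d₀ + γ₀ + 2 ≤ D ∧
        ((∃ t₀ : ↥fccKissingPattern → EuclideanSpace ℝ (Fin 3),
            (∀ u : ↥fccKissingPattern, t₀ u ∈ net k ∧ ‖(t₀ u - x) - d₀ • A (u : EuclideanSpace ℝ (Fin 3))‖ ≤ η₀ * d₀) ∧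
            (∀ z ∈ net k, z ≠ x → dist z x < 13 / 10 * d₀ + γ₀ → dist z x ≤ 13 / 10 * d₀ - γ₀ ∧ z ∈ Set.range t₀)) ∨
         (∃ t₀ : ↥hcpKissingPattern → EuclideanSpace ℝ (Fin 3),
            (∀ u : ↥hcpKissingPattern, t₀ u ∈ net k ∧ ‖(t₀ u - x) - d₀ • A (u : EuclideanSpace ℝ (Fin 3))‖ ≤ η₀ * d₀) ∧
            (∀ z ∈ net k, z ≠ x → dist z x < 13 / 10 * d₀ + γ₀ → dist z x ≤ 13 / 10 * d₀ - γ₀ ∧ z ∈ Set.range t₀))))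
    (hB : ∀ k : ι, ¬ good k → (∀ z ∈ net k, ∀ z' ∈ net k, z ≠ z' → 2 * τ < dist z z') ∧
      ∀ x ∈ net k, ‖x‖ ≤ h + 2 * c + τ → ∃ (z₁ : EuclideanSpace ℝ (Fin 3)) (d₁ : ℝ), z₁ ∈ net k ∧ z₁ ≠ x ∧ dist z₁ x ≤ d₁ ∧
        23 / 10 * (d₁ + 2 * τ + 2 * ε) + 1 ≤ D ∧ ‖x‖ + τ + 9 / 8 * (d₁ + 2 * τ + 2 * ε) + σ ≤ Rc ∧
        (∀ dk : ℝ, (7 : ℝ) / 10 ≤ dk → ∀ A : EuclideanSpace ℝ (Fin 3) →ₗᵢ[ℝ] EuclideanSpace ℝ (Fin 3),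
          ¬ ((∀ u ∈ fccKissingPattern, ∃ z ∈ net k, dist (z - x) (dk • A u) ≤ dk / 8 + σ + 2 * τ) ∧
              (∀ z ∈ net k, z ≠ x → dist z x + σ + 4 * τ ≤ 13 / 10 * dk →
                ∃ u ∈ fccKissingPattern, dist (z - x) (dk • A u) ≤ dk / 8 + σ + 2 * τ))) ∧
        (∀ dk : ℝ, (7 : ℝ) / 10 ≤ dk → ∀ A : EuclideanSpace ℝ (Fin 3) →ₗᵢ[ℝ] EuclideanSpace ℝ (Fin 3),
          ¬ ((∀ u ∈ hcpKissingPattern, ∃ z ∈ net k, dist (z - x) (dk • A u) ≤ dk / 8 + σ + 2 * τ) ∧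
              (∀ z ∈ net k, z ≠ x → dist z x + σ + 4 * τ ≤ 13 / 10 * dk →
                ∃ u ∈ hcpKissingPattern, dist (z - x) (dk • A u) ≤ dk / 8 + σ + 2 * τ))))
    (hcv : ∀ k : ι, ∀ w : EuclideanSpace ℝ (Fin 3), ‖w‖ ≤ h + c → ∃ z ∈ net k, dist w z ≤ c - τ) :
    (∀ j : Fin N, dist (y j) (y i) ≤ ρ → Gy (1 / 8) N y j) ∨ (∀ j : Fin N, dist (y j) (y i) ≤ ρ → ¬ Gy (1 / 8) N y j) := by
  have hρR : ρ ≤ R := by linarith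
  have h2ε : 2 * ε < δ := by linarith
  -- the host verdict of an atom: coherent with SOME good template
  refine FrustratedLawDichotomyTexturePropagation.uniformVerdict_of_windowVerdict_of_cover
    (V := fun p => ∃ k : ι, ((∀ x ∈ net k, (closedBall x τ ∩ (fun s => s - p) '' S).Nonempty) ∧
      (fun s => s - p) '' S ∩ closedBall (0 : EuclideanSpace ℝ (Fin 3)) Rc ⊆ ⋃ x ∈ net k, closedBall x τ) ∧ good k)
    (G := fun j => Gy (1 / 8) N y j) h0 hm1 hm2 hε0.le hρ hρR hρR' hR'R hh hc ?_ ?_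
  · -- window verdicts
    intro p hp hpR q hq hpq j hj
    have hqn : ‖q‖ ≤ R' + (h + 2 * c) := by
      have h1 : ‖q‖ ≤ ‖p‖ + dist p q := by
        have := norm_add_le p (q - p); rwa [add_sub_cancel, ← dist_eq_norm, dist_comm] at this
      linarith
    have hjρ : dist (y j) (y i) ≤ R' + (h + 2 * c) + ε := by
      have h1 : ‖y j - y i‖ ≤ ‖q - 0‖ + dist (y j - y i) (q - 0) := by
        have := norm_add_le (q - 0) ((y j - y i) - (q - 0)); rwa [add_sub_cancel, ← dist_eq_norm] at this
      rw [sub_zero, ← dist_eq_norm] at h1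
      have hj0 := hj
      rw [sub_zero] at hj0
      linarith
    have hR : D + (R' + (h + 2 * c) + ε) + ε ≤ R := hRbig
    by_cases hV : ∃ k : ι, ((∀ x ∈ net k, (closedBall x τ ∩ (fun s => s - p) '' S).Nonempty) ∧
        (fun s => s - p) '' S ∩ closedBall (0 : EuclideanSpace ℝ (Fin 3)) Rc ⊆ ⋃ x ∈ net k, closedBall x τ) ∧ good k
    · obtain ⟨k, ⟨hne, hsub⟩, hgk⟩ := hV
      exact iff_of_true (gy_of_goodWindow hS hτ h2τ hLRc hq hpq hne hsub hsepY hm1 hm2 hj hjρ hε0 hεδ hε7 hR (hG k hgk))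
        ⟨k, ⟨hne, hsub⟩, hgk⟩
    · obtain ⟨k, hne, hsub⟩ := hcoh p hp hpR
      have hbk : ¬ good k := fun hg => hV ⟨k, ⟨hne, hsub⟩, hg⟩
      exact iff_of_false (not_gy_of_badWindow hS hτ h2τ hLRc hq hpq (hB k hbk).1 hne hsub hsepY hm1 hm2 hj hjρ hε0.le hσ h2ε h4ε hR
        (hB k hbk).2) hV
  · -- covering
    intro q hq hqR w hwq
    obtain ⟨k, hne, -⟩ := hcoh q hq hqR
    have hwn : ‖w - q‖ ≤ h + c := by rwa [← dist_eq_norm]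
    obtain ⟨z, hz, hwz⟩ := hcv k (w - q) hwn
    obtain ⟨s', hs'z, ⟨s, hs, rfl⟩⟩ := hne z hz
    refine ⟨s, hs, ?_⟩
    have h1 : dist s w = dist (s - q) (w - q) := by rw [dist_sub_right]
    rw [h1]
    have h2 := dist_triangle (s - q) z (w - q)
    have h3 : dist (s - q) z ≤ τ := mem_closedBall.mp hs'z
    rw [dist_comm z] at h2
    linarith

/-- ★ **The (FLIP) hypothesis of #58 for ONE rooted hard-core configuration.**  For `μ = count.restrict S` (`IsRootedHardCore δ μ`) the premiss
`∀ p, μ {p} ≠ 0 → ‖p‖ ≤ R' → Measure.map (· - p) μ ∈ ⋃ k, coherentAt (net k) τ Rc` is read at set level through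
`Literature.Probability.Process.map_sub_count_restrict` and `…CoherentSets.count_restrict_mem_coherentAt_iff'`, and `uniformVerdict_of_coherentAtoms`
gives the uniform verdict. [folklore] -/
theorem hflip_of_net {μ : Measure (EuclideanSpace ℝ (Fin 3))} {δ τ Rc D σ h c : ℝ} (hμ : IsRootedHardCore δ μ)
    (hτ : 0 ≤ τ) (h2τ : 2 * τ < δ) (hh : 0 < h) (hc : 0 ≤ c) (hLRc : h + 2 * c ≤ Rc)
    {ι : Type*} (net : ι → Finset (EuclideanSpace ℝ (Fin 3))) (good : ι → Prop) {R ρ R' ε : ℝ}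
    (hε0 : 0 < ε) (hεδ : 8 * ε < δ) (hε7 : 8 * ε < 7 / 10) (hσ : 0 < σ) (h4ε : 4 * ε ≤ σ)
    (hρ : 0 ≤ ρ) (hρR' : ρ + ε ≤ R') (hRbig : D + (R' + (h + 2 * c) + ε) + ε ≤ R) (hR'R : R' ≤ R)
    (hG : ∀ k : ι, good k → ∀ x ∈ net k, ‖x‖ ≤ h + 2 * c + τ →
      ∃ (A : EuclideanSpace ℝ (Fin 3) →ₗᵢ[ℝ] EuclideanSpace ℝ (Fin 3)) (d₀ η₀ γ₀ : ℝ), 0 < d₀ ∧ 0 ≤ η₀ ∧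
        (∀ z ∈ net k, z ≠ x → d₀ ≤ dist z x) ∧ (∃ z ∈ net k, z ≠ x ∧ dist z x ≤ d₀) ∧
        η₀ * d₀ + 4 * τ < 1 / 8 * (d₀ - 2 * τ) ∧ 46 / 10 * τ < γ₀ ∧ ‖x‖ + 13 / 10 * d₀ + γ₀ + 4 * τ ≤ Rc ∧
        80 * ε ≤ d₀ - 34 * τ - 8 * (η₀ * d₀) ∧ 10 * ε ≤ γ₀ - 46 / 10 * τ ∧ 2 * d₀ + γ₀ + 2 ≤ D ∧
        ((∃ t₀ : ↥fccKissingPattern → EuclideanSpace ℝ (Fin 3),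
            (∀ u : ↥fccKissingPattern, t₀ u ∈ net k ∧ ‖(t₀ u - x) - d₀ • A (u : EuclideanSpace ℝ (Fin 3))‖ ≤ η₀ * d₀) ∧
            (∀ z ∈ net k, z ≠ x → dist z x < 13 / 10 * d₀ + γ₀ → dist z x ≤ 13 / 10 * d₀ - γ₀ ∧ z ∈ Set.range t₀)) ∨
         (∃ t₀ : ↥hcpKissingPattern → EuclideanSpace ℝ (Fin 3),
            (∀ u : ↥hcpKissingPattern, t₀ u ∈ net k ∧ ‖(t₀ u - x) - d₀ • A (u : EuclideanSpace ℝ (Fin 3))‖ ≤ η₀ * d₀) ∧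
            (∀ z ∈ net k, z ≠ x → dist z x < 13 / 10 * d₀ + γ₀ → dist z x ≤ 13 / 10 * d₀ - γ₀ ∧ z ∈ Set.range t₀))))
    (hB : ∀ k : ι, ¬ good k → (∀ z ∈ net k, ∀ z' ∈ net k, z ≠ z' → 2 * τ < dist z z') ∧
      ∀ x ∈ net k, ‖x‖ ≤ h + 2 * c + τ → ∃ (z₁ : EuclideanSpace ℝ (Fin 3)) (d₁ : ℝ), z₁ ∈ net k ∧ z₁ ≠ x ∧ dist z₁ x ≤ d₁ ∧
        23 / 10 * (d₁ + 2 * τ + 2 * ε) + 1 ≤ D ∧ ‖x‖ + τ + 9 / 8 * (d₁ + 2 * τ + 2 * ε) + σ ≤ Rc ∧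
        (∀ dk : ℝ, (7 : ℝ) / 10 ≤ dk → ∀ A : EuclideanSpace ℝ (Fin 3) →ₗᵢ[ℝ] EuclideanSpace ℝ (Fin 3),
          ¬ ((∀ u ∈ fccKissingPattern, ∃ z ∈ net k, dist (z - x) (dk • A u) ≤ dk / 8 + σ + 2 * τ) ∧
              (∀ z ∈ net k, z ≠ x → dist z x + σ + 4 * τ ≤ 13 / 10 * dk →
                ∃ u ∈ fccKissingPattern, dist (z - x) (dk • A u) ≤ dk / 8 + σ + 2 * τ))) ∧
        (∀ dk : ℝ, (7 : ℝ) / 10 ≤ dk → ∀ A : EuclideanSpace ℝ (Fin 3) →ₗᵢ[ℝ] EuclideanSpace ℝ (Fin 3),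
          ¬ ((∀ u ∈ hcpKissingPattern, ∃ z ∈ net k, dist (z - x) (dk • A u) ≤ dk / 8 + σ + 2 * τ) ∧
              (∀ z ∈ net k, z ≠ x → dist z x + σ + 4 * τ ≤ 13 / 10 * dk →
                ∃ u ∈ hcpKissingPattern, dist (z - x) (dk • A u) ≤ dk / 8 + σ + 2 * τ))))
    (hcv : ∀ k : ι, ∀ w : EuclideanSpace ℝ (Fin 3), ‖w‖ ≤ h + c → ∃ z ∈ net k, dist w z ≤ c - τ) :
    (∀ p : EuclideanSpace ℝ (Fin 3), μ {p} ≠ 0 → ‖p‖ ≤ R' →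
        Measure.map (fun z : EuclideanSpace ℝ (Fin 3) => z - p) μ ∈ ⋃ k : ι, FrustratedLawDichotomyCoherentSets.coherentAt (net k) τ Rc) →
      ∀ (N : ℕ) (y : Fin N → EuclideanSpace ℝ (Fin 3)) (i : Fin N), (∀ a b : Fin N, a ≠ b → (7 : ℝ) / 10 ≤ dist (y a) (y b)) →
        (∀ p : EuclideanSpace ℝ (Fin 3), μ {p} ≠ 0 → dist p 0 ≤ R → ∃ k : Fin N, dist (y k - y i) (p - 0) ≤ ε) →
        (∀ k : Fin N, dist (y k) (y i) ≤ R → ∃ p : EuclideanSpace ℝ (Fin 3), μ {p} ≠ 0 ∧ dist (y k - y i) (p - 0) ≤ ε) →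
        (∀ j : Fin N, dist (y j) (y i) ≤ ρ → Gy (1 / 8) N y j) ∨ (∀ j : Fin N, dist (y j) (y i) ≤ ρ → ¬ Gy (1 / 8) N y j) := by
  obtain ⟨S, h0S, hS, rfl⟩ := hμ
  intro hall N y i hsepY hfwd hbwd
  have hmem : ∀ p : EuclideanSpace ℝ (Fin 3), (Measure.count : Measure (EuclideanSpace ℝ (Fin 3))).restrict S {p} ≠ 0 ↔ p ∈ S :=
    count_restrict_singleton_ne_zero_iff S
  have hm1 : ∀ s ∈ S, dist s (0 : EuclideanSpace ℝ (Fin 3)) ≤ R → ∃ b : Fin N, dist (y b - y i) (s - 0) ≤ ε :=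
    fun s hs => hfwd s ((hmem s).2 hs)
  have hm2 : ∀ b : Fin N, dist (y b) (y i) ≤ R → ∃ s ∈ S, dist (y b - y i) (s - 0) ≤ ε := fun b hb => by
    obtain ⟨s, hs, h⟩ := hbwd b hb
    exact ⟨s, (hmem s).1 hs, h⟩
  have hcoh : ∀ p ∈ S, ‖p‖ ≤ R' → ∃ k : ι, (∀ x ∈ net k, (closedBall x τ ∩ (fun s => s - p) '' S).Nonempty) ∧
      (fun s => s - p) '' S ∩ closedBall (0 : EuclideanSpace ℝ (Fin 3)) Rc ⊆ ⋃ x ∈ net k, closedBall x τ := by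
    intro p hp hpR
    have h1 := hall p ((hmem p).2 hp) hpR
    rw [map_sub_count_restrict, mem_iUnion] at h1
    obtain ⟨k, hk⟩ := h1
    exact ⟨k, (FrustratedLawDichotomyCoherentSets.count_restrict_mem_coherentAt_iff' _ _ _ _).mp hk⟩
  exact uniformVerdict_of_coherentAtoms hS h0S hτ h2τ hh hc hLRc net good hsepY hm1 hm2 hε0 hεδ hε7 hσ h4ε hρ hρR' hRbig hR'R hcoh hG hB hcv

/-- ★★ **THE LIFT `htex_of_coherentNet`.**  Under the crux hypotheses `hcore`, `happr` (with the crux's own `R₇ R₈ R₉`) and the NET DATA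
(`hG` / `hB` / `hcv` at a matching tolerance `ε` with `8ε < δ`, `8ε < 7/10`, `4ε ≤ σ`; `2τ < δ`; `h + 2c ≤ Rc`), a.s. SOME atom's re-rooting is
incoherent with every template of the net: the texture input `htex` of #56 for `C := ⋃ k, coherentAt (net k) τ Rc`.  The radii are chosen HERE,
after `R₈, R₉`: `ρ := max (max R₈ R₉) 0`, `R' := ρ + ε`, `R := D + (R' + (h + 2c) + ε) + ε`; the coherent radius `Rc` is the net's constant.
MEASURE STEP = the tree theorem #58, quoted verbatim:
`theorem ae_exists_incoherent_reroot {δ : ℝ} {P : Measure (Measure (EuclideanSpace ℝ (Fin 3)))} (hcore : ∀ᵐ μ ∂P, IsRootedHardCore δ μ)`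
`  (happr : ∀ᵐ μ ∂P, ApprM μ R₇ R₈ R₉) {R ρ R' ε : ℝ} (hR : 0 ≤ R) (hR₉ : R₉ ≤ R) (hρ₈ : R₈ ≤ ρ) (hρ₉ : R₉ ≤ ρ)`
`  (hε : 0 < ε) (C : Set (Measure (EuclideanSpace ℝ (Fin 3))))`
`  (hflip : ∀ᵐ μ ∂P, (∀ p, μ {p} ≠ 0 → ‖p‖ ≤ R' → Measure.map (fun z => z - p) μ ∈ C) →`
`    ∀ (N : ℕ) (y : Fin N → E3) (i : Fin N), (∀ a b, a ≠ b → 7/10 ≤ dist (y a) (y b)) →`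
`      (∀ p, μ {p} ≠ 0 → dist p 0 ≤ R → ∃ k, dist (y k - y i) (p - 0) ≤ ε) →`
`      (∀ k, dist (y k) (y i) ≤ R → ∃ p, μ {p} ≠ 0 ∧ dist (y k - y i) (p - 0) ≤ ε) →`
`      (∀ j, dist (y j) (y i) ≤ ρ → Gy (1/8) N y j) ∨ (∀ j, dist (y j) (y i) ≤ ρ → ¬ Gy (1/8) N y j)) :`
`  ∀ᵐ μ ∂P, ∃ p, μ {p} ≠ 0 ∧ Measure.map (fun z => z - p) μ ∉ C`,
with `hflip` supplied pointwise by `hflip_of_net`. [folklore] -/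
theorem ae_exists_incoherent_reroot_of_net {δ : ℝ} {P : Measure (Measure (EuclideanSpace ℝ (Fin 3)))}
    (hcore : ∀ᵐ μ ∂P, IsRootedHardCore δ μ) {R₇ R₈ R₉ : ℝ} (happr : ∀ᵐ μ ∂P, ApprM μ R₇ R₈ R₉)
    {τ Rc D σ h c ε : ℝ} (hτ : 0 ≤ τ) (h2τ : 2 * τ < δ) (hh : 0 < h) (hc : 0 ≤ c) (hLRc : h + 2 * c ≤ Rc) (hD : 0 ≤ D)
    (hε0 : 0 < ε) (hεδ : 8 * ε < δ) (hε7 : 8 * ε < 7 / 10) (hσ : 0 < σ) (h4ε : 4 * ε ≤ σ)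
    {ι : Type*} (net : ι → Finset (EuclideanSpace ℝ (Fin 3))) (good : ι → Prop)
    (hG : ∀ k : ι, good k → ∀ x ∈ net k, ‖x‖ ≤ h + 2 * c + τ →
      ∃ (A : EuclideanSpace ℝ (Fin 3) →ₗᵢ[ℝ] EuclideanSpace ℝ (Fin 3)) (d₀ η₀ γ₀ : ℝ), 0 < d₀ ∧ 0 ≤ η₀ ∧
        (∀ z ∈ net k, z ≠ x → d₀ ≤ dist z x) ∧ (∃ z ∈ net k, z ≠ x ∧ dist z x ≤ d₀) ∧
        η₀ * d₀ + 4 * τ < 1 / 8 * (d₀ - 2 * τ) ∧ 46 / 10 * τ < γ₀ ∧ ‖x‖ + 13 / 10 * d₀ + γ₀ + 4 * τ ≤ Rc ∧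
        80 * ε ≤ d₀ - 34 * τ - 8 * (η₀ * d₀) ∧ 10 * ε ≤ γ₀ - 46 / 10 * τ ∧ 2 * d₀ + γ₀ + 2 ≤ D ∧
        ((∃ t₀ : ↥fccKissingPattern → EuclideanSpace ℝ (Fin 3),
            (∀ u : ↥fccKissingPattern, t₀ u ∈ net k ∧ ‖(t₀ u - x) - d₀ • A (u : EuclideanSpace ℝ (Fin 3))‖ ≤ η₀ * d₀) ∧
            (∀ z ∈ net k, z ≠ x → dist z x < 13 / 10 * d₀ + γ₀ → dist z x ≤ 13 / 10 * d₀ - γ₀ ∧ z ∈ Set.range t₀)) ∨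
         (∃ t₀ : ↥hcpKissingPattern → EuclideanSpace ℝ (Fin 3),
            (∀ u : ↥hcpKissingPattern, t₀ u ∈ net k ∧ ‖(t₀ u - x) - d₀ • A (u : EuclideanSpace ℝ (Fin 3))‖ ≤ η₀ * d₀) ∧
            (∀ z ∈ net k, z ≠ x → dist z x < 13 / 10 * d₀ + γ₀ → dist z x ≤ 13 / 10 * d₀ - γ₀ ∧ z ∈ Set.range t₀))))
    (hB : ∀ k : ι, ¬ good k → (∀ z ∈ net k, ∀ z' ∈ net k, z ≠ z' → 2 * τ < dist z z') ∧
      ∀ x ∈ net k, ‖x‖ ≤ h + 2 * c + τ → ∃ (z₁ : EuclideanSpace ℝ (Fin 3)) (d₁ : ℝ), z₁ ∈ net k ∧ z₁ ≠ x ∧ dist z₁ x ≤ d₁ ∧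
        23 / 10 * (d₁ + 2 * τ + 2 * ε) + 1 ≤ D ∧ ‖x‖ + τ + 9 / 8 * (d₁ + 2 * τ + 2 * ε) + σ ≤ Rc ∧
        (∀ dk : ℝ, (7 : ℝ) / 10 ≤ dk → ∀ A : EuclideanSpace ℝ (Fin 3) →ₗᵢ[ℝ] EuclideanSpace ℝ (Fin 3),
          ¬ ((∀ u ∈ fccKissingPattern, ∃ z ∈ net k, dist (z - x) (dk • A u) ≤ dk / 8 + σ + 2 * τ) ∧
              (∀ z ∈ net k, z ≠ x → dist z x + σ + 4 * τ ≤ 13 / 10 * dk →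
                ∃ u ∈ fccKissingPattern, dist (z - x) (dk • A u) ≤ dk / 8 + σ + 2 * τ))) ∧
        (∀ dk : ℝ, (7 : ℝ) / 10 ≤ dk → ∀ A : EuclideanSpace ℝ (Fin 3) →ₗᵢ[ℝ] EuclideanSpace ℝ (Fin 3),
          ¬ ((∀ u ∈ hcpKissingPattern, ∃ z ∈ net k, dist (z - x) (dk • A u) ≤ dk / 8 + σ + 2 * τ) ∧
              (∀ z ∈ net k, z ≠ x → dist z x + σ + 4 * τ ≤ 13 / 10 * dk →
                ∃ u ∈ hcpKissingPattern, dist (z - x) (dk • A u) ≤ dk / 8 + σ + 2 * τ))))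
    (hcv : ∀ k : ι, ∀ w : EuclideanSpace ℝ (Fin 3), ‖w‖ ≤ h + c → ∃ z ∈ net k, dist w z ≤ c - τ) :
    ∀ᵐ μ ∂P, ∃ p : EuclideanSpace ℝ (Fin 3), μ {p} ≠ 0 ∧
      Measure.map (fun z : EuclideanSpace ℝ (Fin 3) => z - p) μ ∉ ⋃ k : ι, FrustratedLawDichotomyCoherentSets.coherentAt (net k) τ Rc := by
  have hρ : (0 : ℝ) ≤ max (max R₈ R₉) 0 := le_max_right _ _
  have hρ₈ : R₈ ≤ max (max R₈ R₉) 0 := (le_max_left _ _).trans (le_max_left _ _)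
  have hρ₉ : R₉ ≤ max (max R₈ R₉) 0 := (le_max_right _ _).trans (le_max_left _ _)
  have hR0 : (0 : ℝ) ≤ D + ((max (max R₈ R₉) 0 + ε) + (h + 2 * c) + ε) + ε := by
    have : 0 ≤ h + 2 * c := by linarith
    positivity
  have hR₉ : R₉ ≤ D + ((max (max R₈ R₉) 0 + ε) + (h + 2 * c) + ε) + ε := by nlinarith
  refine FrustratedLawDichotomyTextureIncoherence.ae_exists_incoherent_reroot hcore happr (ρ := max (max R₈ R₉) 0)
    (R' := max (max R₈ R₉) 0 + ε) hR0 hR₉ hρ₈ hρ₉ hε0 _ ?_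
  filter_upwards [hcore] with μ hμ
  exact hflip_of_net hμ hτ h2τ hh hc hLRc net good hε0 hεδ hε7 hσ h4ε hρ le_rfl le_rfl (by nlinarith) hG hB hcv

end Summit.AtomisticToContinuum.Crystallization.Theorems.FrustratedLawDichotomyTextureLift

end
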